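import Summits.BirchSwinnertonDyer.BirchSwinnertonDyer.Theorems.GenusKolyvaginAtTwoGenusPrimitiveSupplyAtTwoPosDiscShallowKFourPosSelmerProfile
import Summits.BirchSwinnertonDyer.BirchSwinnertonDyer.Theorems.GenusKolyvaginAtTwoGenusDeepSupplyAtTwoNegDiscNarrowKFourCellSelmerCountCurrency
import Literature.NumberTheory.EllipticCurves.HeegnerPointsKolyvaginSelmerProofs
import HarnessLib

/-!
# Route `GenusKolyvaginAtTwo`, kernel items K₄⁺ `K4Pos` (stmt-BirchSwinnertonDyer-31469) / K₄ `K4Neg` (31526) — THE FALSIFIER INTERFACE: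
# ONE cut cell with a deficient descent count (`#Sel_(2^M₀)(E/ℚ) ≠ 4^(M₀)`; at depth two `#Sel₄(E/ℚ) ≠ 16`) REFUTES the route item BY NAME (mod Q2)

Width seat `bsd-line-gk2-p5` g37 (cell `bsd-f1-sign2`), `--supports stmt-BirchSwinnertonDyer-31469 --as helper`.  THEOREMS ONLY (no definition, no
named fact, no `sorry`); standard axioms; the route file is imported to name the items.  **Nothing is refuted here: the hypotheses describe a
HYPOTHETICAL counterexample cell; no such cell is known (BSD predicts none exists).  BSD is NOT proved or disproved by this file; nothing is closed.**

WHY.  The Selmer-count currency (this seat, p774671 / p774760 / p774868 / p775150) says, per cut cell, «K₄-witness ⟺ `#Sel_(2^M₀)(E/ℚ) = 4^(M₀)`».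
Since `K4Pos` / `K4Neg` are `∀`-statements over their frames, ONE frame on the cut where the count is deficient kills the ITEM.  This file types that
interface for cdisprove / `-data`: a certified `2^(M₀)`-descent over `ℚ` returning `< 4^(M₀)` on one K₄⁺ (resp. K₄) census cell with an odd multiplicative
prime, together with the cell's frame data, is a kernel refutation of `K4Pos` (resp. `K4Neg`) modulo Q2 — and (BSD predicting `4^(M₀)`) of BSD₂ there.
* `not_kFourPos_of_deficient_selmerCount_cut_cell` — K₄⁺: frame binders of `K4Pos` VERBATIM + an odd multiplicative prime + `σ₀ ≠ 1` +
  `#Sel_(2^M₀)(E/ℚ) ≠ 4^(M₀)` ⟹ `¬ K4Pos` (mod Q2); depth two `not_kFourPos_of_natCard_selmerGroup_four_ne_sixteen_cut_cell` (`#Sel₄(E/ℚ) ≠ 16`).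
* `not_kFourNeg_of_deficient_selmerCount_cut_cell` — K₄ alike (mod Q2).
BSD is NOT proved by any of this.

References: [Kolyvagin1989Izv] Thm. B₂; [McCallumLMS1991] §5 Thm. 5.4; [SilvermanAEC2009] Thm. X.4.2.
-/

set_option autoImplicit false
-- the Theorems namespace of this sub repeats the summit name by design (D-0017 nested layout)
set_option linter.dupNamespace false

noncomputable section

open scoped Classical
open scoped AddSubgroup

namespace Summit.BirchSwinnertonDyer.BirchSwinnertonDyer.Theorems.GenusExact.PlusDescent

open WeierstrassCurve NumberField IsDedekindDomain Field Literature.NumberTheory.EllipticCurves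
  Literature.NumberTheory.GaloisRepresentations Literature.NumberTheory.EllipticCurves.ModularForms AddSubgroup
  Literature.NumberTheory.EllipticCurves.RingClassField
open Summit.BirchSwinnertonDyer.BirchSwinnertonDyer.Theses.GenusKolyvaginAtTwo (KolyvaginRelationAtTwo K4Pos K4Neg)

/-! ## §1 K₄⁺: one deficient cut cell refutes `K4Pos` -/

/-- **ONE DEFICIENT CUT CELL REFUTES `K4Pos` (mod Q2).**  If some curve on K4Pos's frame (binders VERBATIM: globally minimal non-CM `E/ℚ`, `r_an = 0`,
`ρ_{E,2^n}` onto, odd Tamagawa, `Δ > 0`, the K₄⁺ clause; `K` imaginary quadratic, `d_K = −ℓ₀` odd prime, Heegner, the two non-squares, `2` split;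
odd-Manin `Dt`; `d₁` with `P(1)` of infinite order, `2^(M₀) ∥ P(1)`, `M₀ ≥ 1`; a globally minimal shallow twin `Wd = Cd • E^(d_K)` of analytic rank `1`,
`#Sel₂(Wd) = 2`, `ord₂ C(Wd) = 0`) which ALSO has an odd multiplicative prime `v` (and `σ₀ ≠ 1` in `Aut(K/ℚ)`) satisfies
**`#Sel_(2^M₀)(E/ℚ) ≠ 4^(M₀)`**, then `K4Pos` is FALSE (given Q2): `K4Pos` at that cell gives the witness, and ★★′
(`kFourPos_witness_iff_natCard_selmerGroup_eq_pow_of_cut`) turns the witness into `#Sel_(2^M₀)(E/ℚ) = 4^(M₀)`.  Hypothetical — no such cell is known;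
BSD predicts `#Sel_(2^M₀)(E/ℚ) = 4^(M₀)` (`#Ш_an = 4^(M₀)`) on every such cell.  BSD / K4Pos are NOT proved or refuted by this.
[cite: Kolyvagin1989Izv, Thm. B₂] [cite: McCallumLMS1991, §5 Thm. 5.4] [cite: SilvermanAEC2009, Thm. X.4.2] -/
theorem not_kFourPos_of_deficient_selmerCount_cut_cell (hQ2 : KolyvaginRelationAtTwo)
    (W : WeierstrassCurve ℚ) [W.IsElliptic] [W.IsGloballyMinimal] [NeZero (W.conductorNorm ℤ)] (hcm : ¬ W.HasCM) (hr0 : W.analyticRank = 0)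
    (hρ : ∀ n : ℕ, 0 < n → W.HasSurjectiveModNGaloisRep ((2 : ℤ) ^ n)) (hT : Odd W.tamagawaProduct) (hpos : 0 < W.Δ)
    (h4 : Nat.card (W.selmerGroup 2) = 4 ∧ ∃ c ∈ (W.kummerSelmerStructure ((2 : ℕ) : ℤ)).selmerGroup,
      galoisCohomology.localization (W.torsionGaloisModule ((2 : ℕ) : ℤ)) (Sum.inl Rat.infinitePlace) 1 c ≠ 0)
    (v : HeightOneSpectrum (𝓞 ℚ)) (h2v : ((2 : ℕ) : 𝓞 ℚ) ∉ v.asIdeal) (hNv : ((W.conductorNorm ℤ : ℕ) : 𝓞 ℚ) ∈ v.asIdeal)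
    (hmult : W.HasMultiplicativeReductionAt v)
    (K : Type) [Field K] [NumberField K] (hIQ : IsImaginaryQuadratic K) (hodd : Odd (NumberField.discr K))
    (h3 : NumberField.discr K ≠ -3) (hHe : SatisfiesHeegnerHypothesis (W.conductorNorm ℤ) K)
    (hsq1 : ¬ IsSquare ((NumberField.discr K : ℚ) * -|W.Δ|)) (hsq2 : ¬ IsSquare ((NumberField.discr K : ℚ) * (-(2 * |W.Δ|))))
    (ℓ₀ : ℕ) (hℓ₀ : ℓ₀.Prime) (hdK : NumberField.discr K = -(ℓ₀ : ℤ)) (h2K : ((Ideal.span {(2 : ℤ)}).primesOver (𝓞 K)).ncard = 2)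
    (Dt : ModularParametrizationData W (W.conductorNorm ℤ))
    (hopt : ∀ z ∈ Dt.L.lattice, ∃ w ∈ periodLattice Dt.f, z = (Dt.c : ℂ) * w) (hc : Odd Dt.c)
    (β : ℤ) (ι : K →+* ℂ) (d₁ : KolyvaginHeegnerData Dt β ι 1) (hy : ¬ IsOfFinAddOrder d₁.derivedPoint) (M₀ : ℕ) (hM₀ : 1 ≤ M₀)
    (hdiv : ∃ Q : (W.baseChange (ringClassField K ι 1)).toAffine.Point, ((2 ^ M₀ : ℕ) : ℤ) • Q = d₁.derivedPoint)
    (hndiv : ¬ ∃ Q : (W.baseChange (ringClassField K ι 1)).toAffine.Point, ((2 ^ (M₀ + 1) : ℕ) : ℤ) • Q = d₁.derivedPoint)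
    (Wd : WeierstrassCurve ℚ) [Wd.IsElliptic] [Wd.IsGloballyMinimal] (Cd : VariableChange ℚ) (hCd : Cd • W.quadraticTwist (discr K : ℚ) = Wd)
    (hrd : Wd.analyticRank = 1) (hSel : Nat.card (Wd.selmerGroup 2) = 2) (hDEF : padicValNat 2 Wd.tamagawaProduct = 0)
    (hdeficient : Nat.card (W.selmerGroup ((2 ^ M₀ : ℕ) : ℤ)) ≠ 4 ^ M₀) :
    ¬ K4Pos := by
  intro hK4
  obtain ⟨σ₀, hσ₀, -⟩ := exists_conj_of_isImaginaryQuadratic (K := K) hIQ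
  have hwit := hK4 W hcm hr0 hρ hT hpos h4 K hIQ hodd h3 hHe hsq1 hsq2 ℓ₀ hℓ₀ hdK h2K Dt hopt hc β ι d₁ hy M₀ hdiv hndiv hM₀ Wd ⟨Cd, hCd⟩ hrd hSel hDEF
  exact hdeficient ((kFourPos_witness_iff_natCard_selmerGroup_eq_pow_of_cut W K hQ2 hcm hT v h2v hNv hmult hpos hIQ hodd h3 hHe hsq1 hsq2 hρ Dt β ι
    d₁ hy M₀ hM₀ hdiv hndiv Wd Cd hCd hSel hDEF h4 hr0 h2K hσ₀).mp hwit)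

/-- **DEPTH TWO: a K₄⁺ cut cell with `M₀ = 2` and `#Sel₄(E/ℚ) ≠ 16` refutes `K4Pos` (mod Q2)** — the `4`-descent falsifier.  Hypothetical; BSD
predicts `#Sel₄(E/ℚ) = 16` on every such cell (`16 ∥ #Ш_an`).  BSD / K4Pos are NOT proved or refuted by this. [cite: McCallumLMS1991, §5 Thm. 5.4] -/
theorem not_kFourPos_of_natCard_selmerGroup_four_ne_sixteen_cut_cell (hQ2 : KolyvaginRelationAtTwo)
    (W : WeierstrassCurve ℚ) [W.IsElliptic] [W.IsGloballyMinimal] [NeZero (W.conductorNorm ℤ)] (hcm : ¬ W.HasCM) (hr0 : W.analyticRank = 0)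
    (hρ : ∀ n : ℕ, 0 < n → W.HasSurjectiveModNGaloisRep ((2 : ℤ) ^ n)) (hT : Odd W.tamagawaProduct) (hpos : 0 < W.Δ)
    (h4 : Nat.card (W.selmerGroup 2) = 4 ∧ ∃ c ∈ (W.kummerSelmerStructure ((2 : ℕ) : ℤ)).selmerGroup,
      galoisCohomology.localization (W.torsionGaloisModule ((2 : ℕ) : ℤ)) (Sum.inl Rat.infinitePlace) 1 c ≠ 0)
    (v : HeightOneSpectrum (𝓞 ℚ)) (h2v : ((2 : ℕ) : 𝓞 ℚ) ∉ v.asIdeal) (hNv : ((W.conductorNorm ℤ : ℕ) : 𝓞 ℚ) ∈ v.asIdeal)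
    (hmult : W.HasMultiplicativeReductionAt v)
    (K : Type) [Field K] [NumberField K] (hIQ : IsImaginaryQuadratic K) (hodd : Odd (NumberField.discr K))
    (h3 : NumberField.discr K ≠ -3) (hHe : SatisfiesHeegnerHypothesis (W.conductorNorm ℤ) K)
    (hsq1 : ¬ IsSquare ((NumberField.discr K : ℚ) * -|W.Δ|)) (hsq2 : ¬ IsSquare ((NumberField.discr K : ℚ) * (-(2 * |W.Δ|))))
    (ℓ₀ : ℕ) (hℓ₀ : ℓ₀.Prime) (hdK : NumberField.discr K = -(ℓ₀ : ℤ)) (h2K : ((Ideal.span {(2 : ℤ)}).primesOver (𝓞 K)).ncard = 2)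
    (Dt : ModularParametrizationData W (W.conductorNorm ℤ))
    (hopt : ∀ z ∈ Dt.L.lattice, ∃ w ∈ periodLattice Dt.f, z = (Dt.c : ℂ) * w) (hc : Odd Dt.c)
    (β : ℤ) (ι : K →+* ℂ) (d₁ : KolyvaginHeegnerData Dt β ι 1) (hy : ¬ IsOfFinAddOrder d₁.derivedPoint)
    (hdiv : ∃ Q : (W.baseChange (ringClassField K ι 1)).toAffine.Point, ((2 ^ 2 : ℕ) : ℤ) • Q = d₁.derivedPoint)
    (hndiv : ¬ ∃ Q : (W.baseChange (ringClassField K ι 1)).toAffine.Point, ((2 ^ (2 + 1) : ℕ) : ℤ) • Q = d₁.derivedPoint)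
    (Wd : WeierstrassCurve ℚ) [Wd.IsElliptic] [Wd.IsGloballyMinimal] (Cd : VariableChange ℚ) (hCd : Cd • W.quadraticTwist (discr K : ℚ) = Wd)
    (hrd : Wd.analyticRank = 1) (hSel : Nat.card (Wd.selmerGroup 2) = 2) (hDEF : padicValNat 2 Wd.tamagawaProduct = 0)
    (hdeficient : Nat.card (W.selmerGroup 4) ≠ 16) :
    ¬ K4Pos := by
  refine not_kFourPos_of_deficient_selmerCount_cut_cell hQ2 W hcm hr0 hρ hT hpos h4 v h2v hNv hmult K hIQ hodd h3 hHe hsq1 hsq2 ℓ₀ hℓ₀ hdK h2K Dt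
    hopt hc β ι d₁ hy 2 (by norm_num) hdiv hndiv Wd Cd hCd hrd hSel hDEF ?_
  have e4 : ((2 ^ 2 : ℕ) : ℤ) = 4 := by norm_num
  rw [e4]
  norm_num
  exact hdeficient

/-! ## §2 K₄: one deficient cut cell refutes `K4Neg` -/

/-- **ONE DEFICIENT CUT CELL REFUTES `K4Neg` (mod Q2).**  K4Neg's frame binders VERBATIM + an odd multiplicative prime `v` + `#Sel_(2^M₀)(E/ℚ) ≠ 4^(M₀)`
⟹ `¬ K4Neg`: `K4Neg` at the cell gives the witness, ★ (`kFourNeg_conclusion_iff_natCard_selmerGroup_eq_pow`, p774868) the count.  Hypothetical; BSD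
predicts no such cell.  BSD / K4Neg are NOT proved or refuted by this. [cite: Kolyvagin1989Izv, Thm. B₂] [cite: McCallumLMS1991, §5 Thm. 5.4] -/
theorem not_kFourNeg_of_deficient_selmerCount_cut_cell (hQ2 : KolyvaginRelationAtTwo)
    (W : WeierstrassCurve ℚ) [W.IsElliptic] [W.IsGloballyMinimal] [NeZero (W.conductorNorm ℤ)] (hcm : ¬ W.HasCM) (hr0 : W.analyticRank = 0)
    (hρ : ∀ n : ℕ, 0 < n → W.HasSurjectiveModNGaloisRep ((2 : ℤ) ^ n)) (hT : Odd W.tamagawaProduct) (hneg : W.Δ < 0)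
    (h4 : Nat.card (W.selmerGroup 2) = 4)
    (v : HeightOneSpectrum (𝓞 ℚ)) (h2v : ((2 : ℕ) : 𝓞 ℚ) ∉ v.asIdeal) (hNv : ((W.conductorNorm ℤ : ℕ) : 𝓞 ℚ) ∈ v.asIdeal)
    (hmult : W.HasMultiplicativeReductionAt v)
    (K : Type) [Field K] [NumberField K] (hIQ : IsImaginaryQuadratic K) (hodd : Odd (NumberField.discr K))
    (h3 : NumberField.discr K ≠ -3) (hHe : SatisfiesHeegnerHypothesis (W.conductorNorm ℤ) K)
    (hsq1 : ¬ IsSquare ((NumberField.discr K : ℚ) * -|W.Δ|)) (hsq2 : ¬ IsSquare ((NumberField.discr K : ℚ) * (-(2 * |W.Δ|))))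
    (ℓ₀ : ℕ) (hℓ₀ : ℓ₀.Prime) (hdK : NumberField.discr K = -(ℓ₀ : ℤ)) (h2K : ((Ideal.span {(2 : ℤ)}).primesOver (𝓞 K)).ncard = 2)
    (Dt : ModularParametrizationData W (W.conductorNorm ℤ))
    (hopt : ∀ z ∈ Dt.L.lattice, ∃ w ∈ periodLattice Dt.f, z = (Dt.c : ℂ) * w) (hc : Odd Dt.c)
    (β : ℤ) (ι : K →+* ℂ) (d₁ : KolyvaginHeegnerData Dt β ι 1) (hy : ¬ IsOfFinAddOrder d₁.derivedPoint) (M₀ : ℕ) (hM₀ : 1 ≤ M₀)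
    (hdiv : ∃ Q : (W.baseChange (ringClassField K ι 1)).toAffine.Point, ((2 ^ M₀ : ℕ) : ℤ) • Q = d₁.derivedPoint)
    (hndiv : ¬ ∃ Q : (W.baseChange (ringClassField K ι 1)).toAffine.Point, ((2 ^ (M₀ + 1) : ℕ) : ℤ) • Q = d₁.derivedPoint)
    (Wd : WeierstrassCurve ℚ) [Wd.IsElliptic] [Wd.IsGloballyMinimal]
    (hWd : ∃ C : VariableChange ℚ, C • W.quadraticTwist (NumberField.discr K : ℚ) = Wd) (hrd : Wd.analyticRank = 1)
    (hSel : Nat.card (Wd.selmerGroup 2) = 2) (hDEF : padicValNat 2 Wd.tamagawaProduct ≤ 1)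
    (hdeficient : Nat.card (W.selmerGroup ((2 ^ M₀ : ℕ) : ℤ)) ≠ 4 ^ M₀) :
    ¬ K4Neg := by
  intro hK4
  have hwit := hK4 W hcm hr0 hρ hT hneg h4 K hIQ hodd h3 hHe hsq1 hsq2 ℓ₀ hℓ₀ hdK h2K Dt hopt hc β ι d₁ hy M₀ hdiv hndiv hM₀ Wd hWd hrd hSel hDEF
  exact hdeficient ((kFourNeg_conclusion_iff_natCard_selmerGroup_eq_pow hQ2 W hcm hr0 hρ hT hneg h4 K hIQ hodd h3 hHe hsq1 hsq2 ℓ₀ hℓ₀ hdK h2K Dt hopt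
    hc β ι d₁ hy M₀ hdiv hndiv hM₀ Wd hWd hrd hSel hDEF v h2v hNv hmult).mp hwit)

end Summit.BirchSwinnertonDyer.BirchSwinnertonDyer.Theorems.GenusExact.PlusDescent

end
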